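import Summits.QuantumAdvantage.QuantumAdvantage.Theorems.MobiusLadderLiouvilleOrthogonalTC0SensLtf
import Summits.QuantumAdvantage.QuantumAdvantage.Theorems.MobiusLadderLiouvilleOrthogonalTC0Spectral
import HarnessLib

/-!
# Crux `MobiusLadder.LiouvilleOrthogonalTC0` (stmt-QuantumAdvantage-1393): `λ` is orthogonal to every
Boolean combination of boundedly many linear threshold tests of the binary digits

Line `Sketch` (lead `prover-line-stmt-QuantumAdvantage-1393-c2-0`). For a fixed `K`, every Boolean
function `h : {0,1}^K → {0,1}` and any `K` integer threshold tests `L_l(N) = [θ_l ≤ Σ_i w_{l,i} bit_i(N)]`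
of the digits, the digital function `N ↦ h(L_1(N), …, L_K(N))` is asymptotically orthogonal to `λ`,
uniformly in `h`, `w`, `θ` (Klivans–O'Donnell–Servedio-style union bound on top of Peres: the block
sensitivity of `h ∘ L` is at most the sum of those of the `L_l`, `≤ K · 2ⁿ√m` by `SensLtf.sens_intLtf_le`;
Peres' conclusion `SensLtf.tailWeight_le_of_sens_mul` gives the uniform tail bound `3(K+1)/√m`; the
spectral criterion `liouville_orthogonal_of_tailWeight` finishes). Examples: membership of `N` in a
union of `K/2` intervals, comparisons between digit-weighted sums, the depth-one rung (`K = 1`).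

* `sens_ltf_combination_le` — block sensitivity of `h ∘ (L_1,…,L_K)` is `≤ K · 2ⁿ √m` for every partition;
* `tailWeight_ltf_combination_le` — `W^{≥ m}[sgn ∘ h ∘ L] ≤ 3(K+1)/√m` (`m ≥ 1`);
* `liouville_orthogonal_ltf_combination` — the orthogonality statement (registered stub `stub_ltfCombination`).
-/

set_option linter.dupNamespace false -- D-0017: single-problem summit ⇒ `QuantumAdvantage.QuantumAdvantage` by design

noncomputable section

namespace Summit.QuantumAdvantage.QuantumAdvantage.Theorems.LiouvilleOrthogonalTC0

open Filter Finset Topology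
open Literature.Computability.Complexity
open Literature.Computability.Complexity.LowDegree (tailWeight tailWeight_le_one)
open Literature.Probability.RandomGraphs.LowDegree (sgn)

namespace LtfCombination

variable {n m K : ℕ}

/-- **Union bound for block sensitivity.** For `F = h ∘ (g_1, …, g_K)`: if flipping a block changes
`F`, it changes some `g_l`; hence the block sensitivity of `F` is at most the sum of those of the `g_l`. -/
theorem sens_comp_le (h : (Fin K → Bool) → Bool) (g : Fin K → (Fin n → Bool) → Bool)
    (π : Fin n → Fin m) :
    ∑ x : Fin n → Bool, ((univ.filter fun j : Fin m =>
        h (fun l => g l x) ≠ h (fun l => g l (fun i => xor (x i) (decide (π i = j))))).card : ℝ)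
      ≤ ∑ l : Fin K, ∑ x : Fin n → Bool, ((univ.filter fun j : Fin m =>
          g l x ≠ g l (fun i => xor (x i) (decide (π i = j)))).card : ℝ) := by
  rw [Finset.sum_comm]
  refine Finset.sum_le_sum fun x _ => ?_
  have hsub : (univ.filter fun j : Fin m =>
        h (fun l => g l x) ≠ h (fun l => g l (fun i => xor (x i) (decide (π i = j))))) ⊆
      (univ : Finset (Fin K)).biUnion fun l => univ.filter fun j : Fin m =>
        g l x ≠ g l (fun i => xor (x i) (decide (π i = j))) := by
    intro j hj
    simp only [Finset.mem_filter, Finset.mem_univ, true_and] at hj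
    simp only [Finset.mem_biUnion, Finset.mem_univ, Finset.mem_filter, true_and]
    by_contra hall
    push Not at hall
    exact hj (congrArg h (funext fun l => hall l))
  calc (((univ.filter fun j : Fin m =>
          h (fun l => g l x) ≠ h (fun l => g l (fun i => xor (x i) (decide (π i = j))))).card : ℕ) : ℝ)
      ≤ (((univ : Finset (Fin K)).biUnion fun l => univ.filter fun j : Fin m =>
          g l x ≠ g l (fun i => xor (x i) (decide (π i = j)))).card : ℝ) := by
        exact_mod_cast Finset.card_le_card hsub
    _ ≤ ∑ l : Fin K, (((univ.filter fun j : Fin m =>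
          g l x ≠ g l (fun i => xor (x i) (decide (π i = j)))).card : ℕ) : ℝ) := by
        exact_mod_cast Finset.card_biUnion_le

/-- **Block sensitivity of a Boolean combination of `K` integer threshold functions** is at most
`K · 2ⁿ √m`, for every partition `π`. -/
theorem sens_ltf_combination_le (h : (Fin K → Bool) → Bool) (w : Fin K → Fin n → ℤ) (θ : Fin K → ℤ)
    (π : Fin n → Fin m) :
    ∑ x : Fin n → Bool, ((univ.filter fun j : Fin m =>
        h (fun l => decide (θ l ≤ ∑ i, w l i * (if x i then (1 : ℤ) else 0))) ≠
          h (fun l => decide (θ l ≤ ∑ i, w l i *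
            (if xor (x i) (decide (π i = j)) then (1 : ℤ) else 0)))).card : ℝ)
      ≤ K * (2 ^ n * Real.sqrt m) := by
  have h1 := sens_comp_le h (fun l y => decide (θ l ≤ ∑ i, w l i * (if y i then (1 : ℤ) else 0))) π
  refine h1.trans ?_
  calc ∑ l : Fin K, ∑ x : Fin n → Bool, ((univ.filter fun j : Fin m =>
          decide (θ l ≤ ∑ i, w l i * (if x i then (1 : ℤ) else 0)) ≠
            decide (θ l ≤ ∑ i, w l i *
              (if xor (x i) (decide (π i = j)) then (1 : ℤ) else 0))).card : ℝ)
      ≤ ∑ _l : Fin K, 2 ^ n * Real.sqrt m :=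
        Finset.sum_le_sum fun l _ => SensLtf.sens_intLtf_le (w l) (θ l) π
    _ = K * (2 ^ n * Real.sqrt m) := by
        rw [Finset.sum_const, Finset.card_univ, Fintype.card_fin, nsmul_eq_mul]

/-- **Uniform Fourier tails of Boolean combinations of `K` threshold functions**:
`W^{≥ m}[sgn ∘ h ∘ L] ≤ 3(K+1)/√m` for every `m ≥ 1`, uniformly in `n`, `h` and the tests. -/
theorem tailWeight_ltf_combination_le (h : (Fin K → Bool) → Bool) (w : Fin K → Fin n → ℤ)
    (θ : Fin K → ℤ) (hm : 1 ≤ m) :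
    tailWeight (fun x : Fin n → Bool =>
        sgn (h (fun l => decide (θ l ≤ ∑ i, w l i * (if x i then (1 : ℤ) else 0))))) m
      ≤ 3 * ((K : ℝ) + 1) / Real.sqrt m := by
  have hmpos : (0 : ℝ) < m := Nat.cast_pos.2 (by omega)
  have hs0 : 0 < Real.sqrt m := Real.sqrt_pos.2 hmpos
  have hK0 : (0 : ℝ) ≤ K := Nat.cast_nonneg K
  by_cases hm9 : m ≤ 9
  · have h1 : tailWeight (fun x : Fin n → Bool =>
        sgn (h (fun l => decide (θ l ≤ ∑ i, w l i * (if x i then (1 : ℤ) else 0))))) m ≤ 1 :=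
      tailWeight_le_one (fun x => by
        cases h (fun l => decide (θ l ≤ ∑ i, w l i * (if x i then (1 : ℤ) else 0))) <;> simp) m
    refine h1.trans ?_
    rw [le_div_iff₀ hs0, one_mul]
    calc Real.sqrt m ≤ Real.sqrt ((3 : ℝ) ^ 2) :=
          Real.sqrt_le_sqrt (by norm_num; exact_mod_cast hm9)
      _ = 3 := Real.sqrt_sq (by norm_num)
      _ ≤ 3 * ((K : ℝ) + 1) := by nlinarith
  · have hm10 : 10 ≤ m := by omega
    have h2 := SensLtf.tailWeight_le_of_sens_mul hm10 (B := (K : ℝ))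
      (fun x => h (fun l => decide (θ l ≤ ∑ i, w l i * (if x i then (1 : ℤ) else 0))))
      (fun π => sens_ltf_combination_le h w θ π)
    refine h2.trans (div_le_div_of_nonneg_right ?_ hs0.le)
    nlinarith

end LtfCombination

open LtfCombination in
/-- **`λ` is orthogonal to every Boolean combination of `K` linear threshold tests of the binary
digits** (unconditional): for every `K` and `ε > 0`, for all sufficiently large `n`, every
`h : {0,1}^K → {0,1}` and all integer tests `L_l(N) = [θ_l ≤ Σ_i w_{l,i} bit_i(N)]` satisfy
`|Σ_{N<2ⁿ} λ(N) · sgn h(L_1(N), …, L_K(N))| ≤ ε · 2ⁿ`. -/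
theorem liouville_orthogonal_ltf_combination (K : ℕ) : ∀ ε : ℝ, 0 < ε → ∀ᶠ n : ℕ in atTop,
    ∀ (h : (Fin K → Bool) → Bool) (w : Fin K → Fin n → ℤ) (θ : Fin K → ℤ),
      |∑ N ∈ Finset.range (2 ^ n), ((ArithmeticFunction.liouville N : ℤ) : ℝ) *
          sgn (h (fun l => decide (θ l ≤ ∑ i, w l i * (if Nat.testBit N i then (1 : ℤ) else 0))))|
        ≤ ε * (2 : ℝ) ^ n := by
  intro ε hε
  have hτ : Tendsto (fun m : ℕ => 3 * ((K : ℝ) + 1) / Real.sqrt m) atTop (𝓝 0) :=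
    tendsto_const_nhds.div_atTop (Real.tendsto_sqrt_atTop.comp tendsto_natCast_atTop_atTop)
  filter_upwards [liouville_orthogonal_of_tailWeight (fun m : ℕ => 3 * ((K : ℝ) + 1) / Real.sqrt m)
    hτ ε hε] with n hn h w θ
  exact hn (fun y => h (fun l => decide (θ l ≤ ∑ i, w l i * (if y i then (1 : ℤ) else 0))))
    (fun m hm => tailWeight_ltf_combination_le h w θ hm)

/-- **Registered stub `stub_ltfCombination`**: verbatim `liouville_orthogonal_ltf_combination`. -/
theorem stub_ltfCombination (K : ℕ) : ∀ ε : ℝ, 0 < ε → ∀ᶠ n : ℕ in atTop, ∀ (h : (Fin K → Bool) → Bool) (w : Fin K → Fin n → ℤ) (θ : Fin K → ℤ), |∑ N ∈ Finset.range (2 ^ n), ((ArithmeticFunction.liouville N : ℤ) : ℝ) * sgn (h (fun l => decide (θ l ≤ ∑ i, w l i * (if Nat.testBit N i then (1 : ℤ) else 0))))| ≤ ε * (2 : ℝ) ^ n :=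
  liouville_orthogonal_ltf_combination K

end Summit.QuantumAdvantage.QuantumAdvantage.Theorems.LiouvilleOrthogonalTC0
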